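import Literature.Analysis.FluidPDE.HeatDuhamelBack
import Mathlib.Analysis.Calculus.LineDeriv.IntegrationByParts
import HarnessLib

/-!
# `L²` energy and maximal-regularity estimates for the backward caloric Duhamel integral

Analysis/FluidPDE support file: the `L²` energy estimate and the `L²` maximal regularity of the
heat equation for the backward Duhamel integral `U = 𝒰[Θ]` of a space–time test field `Θ`
(`Literature/Analysis/FluidPDE/HeatDuhamelBack`), i.e. Lemarié-Rieusset 2016, Prop. 4.3 (B)
and (C) (p. 74) after time reversal, **proved**. These are the two linear estimates that drive
the `L²`-duality (Monniaux-type maximal-regularity) proof of local uniqueness of mild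
Navier–Stokes solutions in `C([0,T); L³(ℝ³))` (`Literature.Analysis.FluidPDE.kato_unique`, fact
`Fluid.IsMildNSSolutionOn.ae_eq_Ico_of_ae_eq_Icc_three` of `KatoUniqueness`): testing the
difference `w` of two solutions against `Θ` produces `∫∫ ⟪G, ∇U⟫` with `G = u ⊗ w + w ⊗ v`, and
the two estimates below bound `‖∇U‖_{L²(slab)}` (with the short-time gain `(T - τ₀)^{1/2}`) and
`‖∇²U‖_{L²(slab)}` by `‖Θ‖_{L²(slab)}`.

Let `E` be a finite-dimensional real inner product space (`n = dim E`) with Lebesgue measure,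
`F` a real Hilbert space, `ν > 0`, `Θ : ℝ → E → F` a space–time test field supported in time in
`[a, b]`, `U = 𝒰[Θ] = heatDuhamelBack ν Θ` (so `∂ₛU + νΔU = -Θ`, `U(s) = 0` for `s ≥ b`), `(eᵢ)`
the standard orthonormal frame, `τ₀ ≤ T`, `b ≤ T`, and `Q = ∫_{τ₀}^T ‖Θ(s)‖₂² ds`.

* `IsSpaceTimeTestOn.energy_identity_zero`:
  `‖U(τ)‖₂² + 2ν ∫_τ^T Σᵢ ‖∂ᵢU‖₂² = 2 ∫_τ^T ⟨U, Θ⟩` (Prop. 4.3 (B) as an identity).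
* `IsSpaceTimeTestOn.energy_identity_one`:
  `Σᵢ ‖∂ᵢU(τ)‖₂² + 2ν ∫_τ^T Σᵢⱼ ‖∂ⱼ∂ᵢU‖₂² = -2 ∫_τ^T ⟨ΔU, Θ⟩` (Prop. 4.3 (C) as an identity).
* `IsSpaceTimeTestOn.energy_estimate_zero`: `sup_{τ ∈ [τ₀,T]} ‖U(τ)‖₂² ≤ 4 (T - τ₀) Q` and
  `∫_{τ₀}^T Σᵢ ‖∂ᵢU‖₂² ≤ (2 (T - τ₀)/ν) Q`.
* `IsSpaceTimeTestOn.energy_estimate_one` (**maximal regularity**):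
  `∫_{τ₀}^T Σᵢⱼ ‖∂ⱼ∂ᵢU‖₂² ≤ (n/ν²) Q`.

## Proofs

Pointwise in `x`, `d/ds |U(s,x)|² = 2⟪U, ∂ₛU⟫` (`HasDerivAt.norm_sq` with
`∂ₛU = 𝒰[∂ₜΘ]`), the fundamental theorem of calculus on `[τ, T]` (`U(T) = 0`), Fubini on the
slab `E × (τ, T]` (all pairings of Duhamel fields are jointly integrable: they are bounded,
continuous, with uniformly bounded `L¹` slices — `integrable_prod_inner_of_bound`), the
backward heat equation `∂ₛU = -νΔU - Θ`, and the boundary-free integrations by parts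
`∫⟪U, ΔU⟫ = -Σᵢ ‖∂ᵢU‖₂²` (Mathlib `integral_bilinear_hasFDerivAt_right_eq_neg_left_of_integrable`)
and `Σᵢ∫⟪∂ᵢU, ∂ᵢΘ⟫ = -∫⟪ΔU, Θ⟫` (tree `integral_inner_laplacian_add_eq_zero`, `Θ(s)` compactly
supported) give the identities; the second is the first applied to the data `∂ᵢΘ`
(`∂ᵢU = 𝒰[∂ᵢΘ]`). The estimates follow by Cauchy–Schwarz on the slab
(`integral_abs_inner_le_sqrt_mul_sqrt`): `J = ∫∫|⟪U,Θ⟫| ≤ ‖U‖_{L²(slab)} Q^{1/2}` with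
`‖U‖²_{L²(slab)} ≤ 2J(T - τ₀)` forces `J ≤ 2(T - τ₀)Q`; and
`2νX ≤ 2‖ΔU‖_{L²(slab)} Q^{1/2}` with `‖ΔU‖² ≤ n Σᵢⱼ‖∂ⱼ∂ᵢU‖²` (`norm_laplacian_sq_le`) forces
`X ≤ nQ/ν²`. (Lemarié-Rieusset proves (B) by the same energy computation and (C) on the Fourier
side; the physical-space route avoids Plancherel.)

## Mathlib / tree search

Mathlib (this pin) has no heat-equation energy estimates (searched `maximal regularity`, `energy`
in `Analysis/`); used: `HasDerivAt.norm_sq`, `intervalIntegral.integral_eq_sub_of_hasDerivAt`,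
`integral_integral_swap`, `integrable_prod_iff'`, `integral_mul_le_Lp_mul_Lq_of_nonneg`,
`MemLp.integrable_mul`, `sq_sum_le_card_mul_sum_sq`. From the tree: `HeatDuhamelBack` (all of
it) and `Fluid.integral_inner_laplacian_add_eq_zero` (`WholeSpaceIBP`).

## References

* P. G. Lemarié-Rieusset, *The Navier–Stokes problem in the 21st century*, CRC Press 2016,
  Prop. 4.3 (B), (C) and their proofs, pp. 74–75. Bib key `LemarieRieusset2016`.
* S. Monniaux, *Uniqueness of mild solutions of the Navier–Stokes equation and maximal
  `L^p`-regularity*, C. R. Acad. Sci. Paris 328 (1999), 663–668 (as reported in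
  Lemarié-Rieusset 2016, pp. 150–151: maximal regularity as the engine of uniqueness in `L³`).
-/

open MeasureTheory Filter Topology Set InnerProductSpace Metric Function TopologicalSpace
open scoped Real ENNReal NNReal Laplacian ContDiff RealInnerProductSpace

noncomputable section

namespace Literature.Analysis.FluidPDE

variable {E : Type*} [NormedAddCommGroup E] [InnerProductSpace ℝ E] [FiniteDimensional ℝ E]
  [MeasurableSpace E] [BorelSpace E]
variable {F : Type*} [NormedAddCommGroup F] [InnerProductSpace ℝ F] [CompleteSpace F]
variable {ν : ℝ} {Θ Θ₁ Θ₂ : ℝ → E → F}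

/-! ### Uniform `L¹` bounds and products of Duhamel fields -/

section Products

omit [InnerProductSpace ℝ F] in
/-- **Uniform `L¹` bound**: `∫ ‖𝒰[Θ](s)‖ ≤ sup_t ‖Θ(t)‖_{L¹} · (b - s)₊` where `[a, b]` contains
the time support of `Θ` (Tonelli and the `L¹` contraction of `e^{νσΔ}`). [folklore] -/
theorem IsSpaceTimeTestOn.integral_norm_heatDuhamelBack_le [NormedSpace ℝ F]
    (hΘ : IsSpaceTimeTestOn (⊤ : Opens (ℝ × E)) Θ) (hν : 0 < ν) {M₁ : ℝ}
    (hM₁ : ∀ t, ∫ y, ‖Θ t y‖ ≤ M₁) {a b : ℝ} (hab : ∀ t, t ∉ Icc a b → Θ t = 0) (s : ℝ) :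
    ∫ x, ‖heatDuhamelBack ν Θ s x‖ ≤ M₁ * max (b - s) 0 := by
  set L : ℝ := max (b - s) 0 with hL_def
  have hL0 : 0 ≤ L := le_max_right _ _
  -- the integrand on `E × (0, L]`
  set Φ : E × ℝ → F := fun q => UnboundedOperators.heatExtension (Θ (s + q.2)) (ν * q.2) q.1 with hΦ_def
  have hcont : ContinuousOn Φ (univ ×ˢ Ioi 0) := by
    have hcq : Continuous fun q : E × ℝ => ((s, q.2, q.1) : ℝ × ℝ × E) := by fun_prop
    have h := ContinuousOn.comp (g := fun p : ℝ × ℝ × E =>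
        UnboundedOperators.heatExtension (Θ (p.1 + p.2.1)) (ν * p.2.1) p.2.2)
      (f := fun q : E × ℝ => ((s, q.2, q.1) : ℝ × ℝ × E)) (s := univ ×ˢ Ioi 0)
      (hΘ.continuousOn_duhamelIntegrand hν) hcq.continuousOn (fun q hq => show 0 < q.2 from hq.2)
    simpa only [Function.comp_def] using h
  set μL : Measure ℝ := volume.restrict (Ioc (0 : ℝ) L) with hμL
  haveI : IsFiniteMeasure μL := isFiniteMeasure_restrict.2 measure_Ioc_lt_top.ne
  have hmeasΦ : AEStronglyMeasurable Φ ((volume : Measure E).prod μL) := by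
    have h := (hcont.mono (prod_mono le_rfl Ioc_subset_Ioi_self) :
        ContinuousOn Φ (univ ×ˢ Ioc (0 : ℝ) L)).aestronglyMeasurable
      (μ := (volume : Measure E).prod (volume : Measure ℝ))
      (MeasurableSet.univ.prod (measurableSet_Ioc : MeasurableSet (Ioc (0 : ℝ) L)))
    have hμ : ((volume : Measure E).prod (volume : Measure ℝ)).restrict (univ ×ˢ Ioc 0 L) =
        (volume : Measure E).prod μL := by
      rw [hμL, ← Measure.prod_restrict, Measure.restrict_univ]
    rwa [hμ] at h
  obtain ⟨M, hM0, hM⟩ := hΘ.exists_norm_le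
  -- joint integrability on `E × (0, L]`
  have hint : Integrable Φ ((volume : Measure E).prod μL) := by
    rw [integrable_prod_iff' hmeasΦ]
    constructor
    · refine (ae_restrict_iff' measurableSet_Ioc).2 (Eventually.of_forall fun σ hσ => ?_)
      exact (integral_norm_heatExtension_le (hΘ.contDiff_slice (s + σ)).continuous
        (hΘ.hasCompactSupport_slice (s + σ)) (mul_pos hν hσ.1)).1
    · refine Integrable.mono' (integrable_const M₁) hmeasΦ.norm.prod_swap.integral_prod_right' ?_
      refine (ae_restrict_iff' measurableSet_Ioc).2 (Eventually.of_forall fun σ hσ => ?_)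
      rw [Real.norm_of_nonneg (integral_nonneg fun _ => norm_nonneg _)]
      exact (integral_norm_heatExtension_le (hΘ.contDiff_slice (s + σ)).continuous
        (hΘ.hasCompactSupport_slice (s + σ)) (mul_pos hν hσ.1)).2.trans (hM₁ (s + σ))
  -- `U s x = ∫_{(0,L]} Φ(x, σ)` and the norm bound
  have hrepr : ∀ x, heatDuhamelBack ν Θ s x = ∫ σ, Φ (x, σ) ∂μL := fun x =>
    hΘ.heatDuhamelBack_eq_setIntegral_Ioc hν hab hL0 (le_max_left _ _) x
  calc ∫ x, ‖heatDuhamelBack ν Θ s x‖ = ∫ x, ‖∫ σ, Φ (x, σ) ∂μL‖ := by simp_rw [hrepr]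
    _ ≤ ∫ x, ∫ σ, ‖Φ (x, σ)‖ ∂μL := by
        refine integral_mono_of_nonneg (Eventually.of_forall fun x => norm_nonneg _)
          hint.norm.integral_prod_left (Eventually.of_forall fun x => ?_)
        exact norm_integral_le_integral_norm _
    _ = ∫ σ, (∫ x, ‖Φ (x, σ)‖) ∂μL := integral_integral_swap hint.norm
    _ ≤ ∫ _σ, M₁ ∂μL := by
        refine integral_mono_of_nonneg (Eventually.of_forall fun σ =>
          integral_nonneg fun _ => norm_nonneg _) (integrable_const M₁) ?_
        refine (ae_restrict_iff' measurableSet_Ioc).2 (Eventually.of_forall fun σ hσ => ?_)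
        exact (integral_norm_heatExtension_le (hΘ.contDiff_slice (s + σ)).continuous
          (hΘ.hasCompactSupport_slice (s + σ)) (mul_pos hν hσ.1)).2.trans (hM₁ (s + σ))
    _ = M₁ * max (b - s) 0 := by
        rw [integral_const, smul_eq_mul, mul_comm]
        simp [hμL, hL_def]

omit [CompleteSpace F] in
/-- Pairings of a bounded continuous field with an integrable field are integrable. [folklore] -/
theorem integrable_inner_of_norm_le {f g : E → F} (hf : Continuous f) {C : ℝ} (hC : ∀ x, ‖f x‖ ≤ C)
    (hg : Integrable g volume) : Integrable (fun x => ⟪f x, g x⟫) volume := by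
  refine (hg.norm.const_mul C).mono' (hf.aestronglyMeasurable.inner hg.1)
    (Eventually.of_forall fun x => ?_)
  calc ‖⟪f x, g x⟫‖ ≤ ‖f x‖ * ‖g x‖ := norm_inner_le_norm _ _
    _ ≤ C * ‖g x‖ := mul_le_mul_of_nonneg_right (hC x) (norm_nonneg _)

omit [CompleteSpace F] in
/-- **Joint integrability of pairings on a time slab.** If `U, G : ℝ → E → F` are jointly
continuous, `U` is bounded and the slices `G s` are integrable with uniformly bounded `L¹`
norms, then `(x, s) ↦ ⟪U s x, G s x⟫` is integrable on `E × (τ, T]`. [folklore] -/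
theorem integrable_prod_inner_of_bound {U G : ℝ → E → F} (hU : Continuous (uncurry U))
    (hG : Continuous (uncurry G)) {C₀ C₁ : ℝ} (hC₀ : ∀ s x, ‖U s x‖ ≤ C₀)
    (hGi : ∀ s, Integrable (G s) volume) (hGb : ∀ s, ∫ x, ‖G s x‖ ≤ C₁) (τ T : ℝ) :
    Integrable (fun q : E × ℝ => ⟪U q.2 q.1, G q.2 q.1⟫)
      ((volume : Measure E).prod (volume.restrict (Ioc τ T))) := by
  set μT : Measure ℝ := volume.restrict (Ioc τ T) with hμT
  haveI : IsFiniteMeasure μT := isFiniteMeasure_restrict.2 measure_Ioc_lt_top.ne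
  have hcont : Continuous fun q : E × ℝ => ⟪U q.2 q.1, G q.2 q.1⟫ :=
    (hU.comp (continuous_snd.prodMk continuous_fst)).inner
      (hG.comp (continuous_snd.prodMk continuous_fst))
  have hmeas : AEStronglyMeasurable (fun q : E × ℝ => ⟪U q.2 q.1, G q.2 q.1⟫)
      ((volume : Measure E).prod μT) := hcont.aestronglyMeasurable
  rw [integrable_prod_iff' hmeas]
  constructor
  · exact Eventually.of_forall fun s =>
      integrable_inner_of_norm_le (hU.comp (continuous_const.prodMk continuous_id)) (hC₀ s) (hGi s)
  · refine Integrable.mono' (integrable_const (C₀ * C₁)) hmeas.norm.prod_swap.integral_prod_right'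
      (Eventually.of_forall fun s => ?_)
    rw [Real.norm_of_nonneg (integral_nonneg fun _ => norm_nonneg _)]
    calc ∫ x, ‖⟪U s x, G s x⟫‖ ≤ ∫ x, C₀ * ‖G s x‖ := by
          refine integral_mono_of_nonneg (Eventually.of_forall fun _ => norm_nonneg _)
            ((hGi s).norm.const_mul C₀) (Eventually.of_forall fun x => ?_)
          calc ‖⟪U s x, G s x⟫‖ ≤ ‖U s x‖ * ‖G s x‖ := norm_inner_le_norm _ _
            _ ≤ C₀ * ‖G s x‖ := mul_le_mul_of_nonneg_right (hC₀ s x) (norm_nonneg _)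
      _ = C₀ * ∫ x, ‖G s x‖ := integral_const_mul _ _
      _ ≤ C₀ * C₁ := by
          have hC₀' : 0 ≤ C₀ := (norm_nonneg _).trans (hC₀ s 0)
          exact mul_le_mul_of_nonneg_left (hGb s) hC₀'

/-- Joint integrability of `⟪𝒰[Θ₁], 𝒰[Θ₂]⟫` on every time slab. [folklore] -/
theorem IsSpaceTimeTestOn.integrable_prod_inner_heatDuhamelBack
    (hΘ₁ : IsSpaceTimeTestOn (⊤ : Opens (ℝ × E)) Θ₁) (hΘ₂ : IsSpaceTimeTestOn (⊤ : Opens (ℝ × E)) Θ₂)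
    (hν : 0 < ν) (τ T : ℝ) :
    Integrable (fun q : E × ℝ => ⟪heatDuhamelBack ν Θ₁ q.2 q.1, heatDuhamelBack ν Θ₂ q.2 q.1⟫)
      ((volume : Measure E).prod (volume.restrict (Ioc τ T))) := by
  obtain ⟨M, hM0, hM⟩ := hΘ₁.exists_norm_le
  obtain ⟨a, b, hab⟩ := hΘ₁.exists_time_support
  obtain ⟨M₁, hM₁0, hM₁⟩ := hΘ₂.exists_integral_norm_slice_le
  obtain ⟨a₂, b₂, hab₂⟩ := hΘ₂.exists_time_support
  -- `‖𝒰[Θ₁](s)‖ ≤ M (b - s)₊` is unbounded as `s → -∞`; on the slab only `s > τ` matters, so we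
  -- freeze the time variable below `τ` (`s ↦ max s τ`), which does not change the integrand there.
  set U : ℝ → E → F := fun s x => heatDuhamelBack ν Θ₁ (max s τ) x with hU_def
  set G : ℝ → E → F := fun s x => heatDuhamelBack ν Θ₂ (max s τ) x with hG_def
  have hmax : Continuous fun s : ℝ => max s τ := continuous_id.max continuous_const
  have hUc : Continuous (uncurry U) :=
    (hΘ₁.continuous_heatDuhamelBack hν).comp ((hmax.comp continuous_fst).prodMk continuous_snd)
  have hGc : Continuous (uncurry G) :=
    (hΘ₂.continuous_heatDuhamelBack hν).comp ((hmax.comp continuous_fst).prodMk continuous_snd)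
  have hUb : ∀ s x, ‖U s x‖ ≤ M * max (b - τ) 0 := fun s x => by
    simp only [hU_def]
    refine (hΘ₁.norm_heatDuhamelBack_le hν hM hab (max s τ) x).trans ?_
    exact mul_le_mul_of_nonneg_left (max_le_max (by linarith [le_max_right s τ]) le_rfl) hM0
  have hGi : ∀ s, Integrable (G s) volume := fun s => hΘ₂.integrable_heatDuhamelBack hν _
  have hGb : ∀ s, ∫ x, ‖G s x‖ ≤ M₁ * max (b₂ - τ) 0 := fun s => by
    refine (hΘ₂.integral_norm_heatDuhamelBack_le hν hM₁ hab₂ (max s τ)).trans ?_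
    exact mul_le_mul_of_nonneg_left (max_le_max (by linarith [le_max_right s τ]) le_rfl) hM₁0
  have h := integrable_prod_inner_of_bound hUc hGc hUb hGi hGb τ T
  -- on the slab `s > τ`, `max s τ = s`
  refine h.congr ?_
  have hS : ∀ᵐ q ∂((volume : Measure E).prod (volume.restrict (Ioc τ T))), q.2 ∈ Ioc τ T :=
    (Measure.quasiMeasurePreserving_snd (μ := (volume : Measure E))
      (ν := volume.restrict (Ioc τ T))).ae (ae_restrict_mem measurableSet_Ioc)
  filter_upwards [hS] with q hq
  simp only [hU_def, hG_def, max_eq_left hq.1.le]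


omit [CompleteSpace F] in
/-- Joint integrability of `⟪𝒰[Θ₁], Θ₂⟫` on every time slab, for a second space–time test field
`Θ₂`. [folklore] -/
theorem IsSpaceTimeTestOn.integrable_prod_inner_heatDuhamelBack_test
    (hΘ₁ : IsSpaceTimeTestOn (⊤ : Opens (ℝ × E)) Θ₁) (hΘ₂ : IsSpaceTimeTestOn (⊤ : Opens (ℝ × E)) Θ₂)
    (hν : 0 < ν) (τ T : ℝ) :
    Integrable (fun q : E × ℝ => ⟪heatDuhamelBack ν Θ₁ q.2 q.1, Θ₂ q.2 q.1⟫)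
      ((volume : Measure E).prod (volume.restrict (Ioc τ T))) := by
  obtain ⟨M, hM0, hM⟩ := hΘ₁.exists_norm_le
  obtain ⟨a, b, hab⟩ := hΘ₁.exists_time_support
  obtain ⟨M₁, hM₁0, hM₁⟩ := hΘ₂.exists_integral_norm_slice_le
  set U : ℝ → E → F := fun s x => heatDuhamelBack ν Θ₁ (max s τ) x with hU_def
  have hmax : Continuous fun s : ℝ => max s τ := continuous_id.max continuous_const
  have hUc : Continuous (uncurry U) :=
    (hΘ₁.continuous_heatDuhamelBack hν).comp ((hmax.comp continuous_fst).prodMk continuous_snd)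
  have hUb : ∀ s x, ‖U s x‖ ≤ M * max (b - τ) 0 := fun s x => by
    simp only [hU_def]
    refine (hΘ₁.norm_heatDuhamelBack_le hν hM hab (max s τ) x).trans ?_
    exact mul_le_mul_of_nonneg_left (max_le_max (by linarith [le_max_right s τ]) le_rfl) hM0
  have hGi : ∀ s, Integrable (Θ₂ s) volume := fun s =>
    (hΘ₂.contDiff_slice s).continuous.integrable_of_hasCompactSupport (hΘ₂.hasCompactSupport_slice s)
  have h := integrable_prod_inner_of_bound hUc hΘ₂.continuous_uncurry hUb hGi hM₁ τ T
  refine h.congr ?_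
  have hS : ∀ᵐ q ∂((volume : Measure E).prod (volume.restrict (Ioc τ T))), q.2 ∈ Ioc τ T :=
    (Measure.quasiMeasurePreserving_snd (μ := (volume : Measure E))
      (ν := volume.restrict (Ioc τ T))).ae (ae_restrict_mem measurableSet_Ioc)
  filter_upwards [hS] with q hq
  simp only [hU_def, max_eq_left hq.1.le]

/-- Integrability in `x` of `⟪𝒰[Θ₁](s), 𝒰[Θ₂](s)⟫`. [folklore] -/
theorem IsSpaceTimeTestOn.integrable_inner_heatDuhamelBack
    (hΘ₁ : IsSpaceTimeTestOn (⊤ : Opens (ℝ × E)) Θ₁) (hΘ₂ : IsSpaceTimeTestOn (⊤ : Opens (ℝ × E)) Θ₂)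
    (hν : 0 < ν) (s : ℝ) :
    Integrable (fun x => ⟪heatDuhamelBack ν Θ₁ s x, heatDuhamelBack ν Θ₂ s x⟫) volume := by
  obtain ⟨M, hM0, hM⟩ := hΘ₁.exists_norm_le
  obtain ⟨a, b, hab⟩ := hΘ₁.exists_time_support
  exact integrable_inner_of_norm_le (hΘ₁.continuous_heatDuhamelBack_space hν s)
    (fun x => hΘ₁.norm_heatDuhamelBack_le hν hM hab s x) (hΘ₂.integrable_heatDuhamelBack hν s)

/-- **Integration by parts between Duhamel fields** (no boundary terms: all fields and their
derivatives are bounded and integrable): for a direction `v`,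
`∫ ⟪𝒰[Θ₁](s), 𝒰[∂ᵥ∂ᵥΘ₂](s)⟫ = -∫ ⟪𝒰[∂ᵥΘ₁](s), 𝒰[∂ᵥΘ₂](s)⟫`, i.e.
`∫ ⟪U₁, ∂ᵥ∂ᵥU₂⟫ = -∫ ⟪∂ᵥU₁, ∂ᵥU₂⟫` (Mathlib
`integral_bilinear_hasFDerivAt_right_eq_neg_left_of_integrable`). [folklore] -/
theorem IsSpaceTimeTestOn.integral_inner_heatDuhamelBack_fderiv_fderiv
    (hΘ₁ : IsSpaceTimeTestOn (⊤ : Opens (ℝ × E)) Θ₁) (hΘ₂ : IsSpaceTimeTestOn (⊤ : Opens (ℝ × E)) Θ₂)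
    (hν : 0 < ν) (s : ℝ) (v : E) :
    ∫ x, ⟪heatDuhamelBack ν Θ₁ s x,
        heatDuhamelBack ν (fun t y => fderiv ℝ (fun z => fderiv ℝ (Θ₂ t) z v) y v) s x⟫ =
      -∫ x, ⟪heatDuhamelBack ν (fun t y => fderiv ℝ (Θ₁ t) y v) s x,
        heatDuhamelBack ν (fun t y => fderiv ℝ (Θ₂ t) y v) s x⟫ := by
  -- the four data fields
  have hΘ₁v := hΘ₁.fderiv_apply_top v
  have hΘ₂v := hΘ₂.fderiv_apply_top v
  have hΘ₂vv := hΘ₂v.fderiv_apply_top v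
  set f : E → F := heatDuhamelBack ν Θ₁ s with hf
  set f' : E → E →L[ℝ] F := heatDuhamelBack ν (fun t y => fderiv ℝ (Θ₁ t) y) s with hf'
  set g : E → F := heatDuhamelBack ν (fun t y => fderiv ℝ (Θ₂ t) y v) s with hg
  set g' : E → E →L[ℝ] F :=
    heatDuhamelBack ν (fun t y => fderiv ℝ (fun z => fderiv ℝ (Θ₂ t) z v) y) s with hg'
  have hff' : ∀ x, HasFDerivAt f (f' x) x := fun x => hΘ₁.hasFDerivAt_heatDuhamelBack hν s x
  have hgg' : ∀ x, HasFDerivAt g (g' x) x := fun x => hΘ₂v.hasFDerivAt_heatDuhamelBack hν s x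
  have hf'v : ∀ x, f' x v = heatDuhamelBack ν (fun t y => fderiv ℝ (Θ₁ t) y v) s x := fun x => by
    rw [hf', ← hΘ₁.fderiv_heatDuhamelBack hν s, hΘ₁.fderiv_heatDuhamelBack_apply hν s x v]
  have hg'v : ∀ x, g' x v =
      heatDuhamelBack ν (fun t y => fderiv ℝ (fun z => fderiv ℝ (Θ₂ t) z v) y v) s x := fun x => by
    rw [hg', ← hΘ₂v.fderiv_heatDuhamelBack hν s, hΘ₂v.fderiv_heatDuhamelBack_apply hν s x v]
  have key := integral_bilinear_hasFDerivAt_right_eq_neg_left_of_integrable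
    (μ := (volume : Measure E)) (B := innerSL ℝ (E := F)) (f := f) (f' := f') (g := g) (g' := g')
    (v := v) ?_ ?_ ?_ (fun x _ => hff' x) (fun x _ => hgg' x)
  · simp_rw [hg'v, hf'v] at key
    exact key
  · simp_rw [hf'v]
    exact hΘ₁v.integrable_inner_heatDuhamelBack hΘ₂v hν s
  · simp_rw [hg'v]
    exact hΘ₁.integrable_inner_heatDuhamelBack hΘ₂vv hν s
  · exact hΘ₁.integrable_inner_heatDuhamelBack hΘ₂v hν s


end Products

/-! ### The energy identities -/

section Energy

omit [MeasurableSpace E] [BorelSpace E] [CompleteSpace F] in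
/-- The slicewise Laplacian data is the frame sum of pure second derivatives. [folklore] -/
theorem IsSpaceTimeTestOn.laplacian_slice_eq_sum (hΘ : IsSpaceTimeTestOn (⊤ : Opens (ℝ × E)) Θ) :
    (fun t => Δ (Θ t)) = fun t y => ∑ i, fderiv ℝ (fun z => fderiv ℝ (Θ t) z
      (stdOrthonormalBasis ℝ E i)) y (stdOrthonormalBasis ℝ E i) := by
  funext t y
  exact laplacian_eq_sum_fderiv_fderiv_normed _ (contDiff_infty.1 (hΘ.contDiff_slice t) 2) y

/-- **`∫ ⟪U, ΔU⟫ = -Σᵢ ∫ ‖∂ᵢU‖²`** for the Duhamel field `U = 𝒰[Θ](s)` (integration by parts in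
each frame direction, `integral_inner_heatDuhamelBack_fderiv_fderiv`). [folklore] -/
theorem IsSpaceTimeTestOn.integral_inner_laplacian_heatDuhamelBack
    (hΘ : IsSpaceTimeTestOn (⊤ : Opens (ℝ × E)) Θ) (hν : 0 < ν) (s : ℝ) :
    ∫ x, ⟪heatDuhamelBack ν Θ s x, heatDuhamelBack ν (fun t => Δ (Θ t)) s x⟫ =
      -∑ i, ∫ x, ‖fderiv ℝ (heatDuhamelBack ν Θ s) x (stdOrthonormalBasis ℝ E i)‖ ^ 2 := by
  set b := stdOrthonormalBasis ℝ E
  have hi : ∀ i, IsSpaceTimeTestOn (⊤ : Opens (ℝ × E))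
      (fun t y => fderiv ℝ (fun z => fderiv ℝ (Θ t) z (b i)) y (b i)) := fun i =>
    (hΘ.fderiv_apply_top (b i)).fderiv_apply_top (b i)
  have hW : ∀ x, heatDuhamelBack ν (fun t => Δ (Θ t)) s x =
      ∑ i, heatDuhamelBack ν (fun t y => fderiv ℝ (fun z => fderiv ℝ (Θ t) z (b i)) y (b i)) s x :=
    fun x => by
    rw [hΘ.laplacian_slice_eq_sum]
    exact heatDuhamelBack_finset_sum Finset.univ (fun i _ => hi i) hν s x
  simp_rw [hW, inner_sum]
  rw [integral_finsetSum _ fun i _ => hΘ.integrable_inner_heatDuhamelBack (hi i) hν s,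
    ← Finset.sum_neg_distrib]
  refine Finset.sum_congr rfl fun i _ => ?_
  rw [hΘ.integral_inner_heatDuhamelBack_fderiv_fderiv hΘ hν s (b i)]
  congr 1
  refine integral_congr_ae (Eventually.of_forall fun x => ?_)
  dsimp only
  rw [hΘ.fderiv_heatDuhamelBack_apply hν s x (b i), real_inner_self_eq_norm_sq]

/-- **First energy identity** (Lemarié-Rieusset 2016, Prop. 4.3 (B), time-reversed): for the
backward Duhamel field `U = 𝒰[Θ]` of a space–time test field `Θ` supported in time in `[a, b]`,
and `τ ≤ T` with `b ≤ T`,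
`‖U(τ)‖₂² + 2ν ∫_τ^T Σᵢ ‖∂ᵢU(s)‖₂² ds = 2 ∫_τ^T ⟨U(s), Θ(s)⟩ ds`.
Proof: pointwise in `x`, `d/ds |U(s,x)|² = 2⟪U, ∂ₛU⟫` with `∂ₛU = 𝒰[∂ₜΘ] = -νΔU - Θ`
(backward heat equation), the fundamental theorem of calculus on `[τ, T]` (`U(T) = 0`), Fubini
on the slab, and `∫⟪U, ΔU⟫ = -Σᵢ‖∂ᵢU‖₂²`. The two time integrands on the left and right are
integrable on `(τ, T]` (`integrableOn_energy_one`, `integrableOn_inner_heatDuhamelBack_test`). [cite: LemarieRieusset2016, Prop. 4.3 (B), p. 74] -/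
theorem IsSpaceTimeTestOn.energy_identity_zero
    (hΘ : IsSpaceTimeTestOn (⊤ : Opens (ℝ × E)) Θ) (hν : 0 < ν) {a b : ℝ}
    (hab : ∀ t, t ∉ Icc a b → Θ t = 0) {τ T : ℝ} (hτT : τ ≤ T) (hbT : b ≤ T) :
    (∫ x, ‖heatDuhamelBack ν Θ τ x‖ ^ 2) +
        2 * ν * ∫ s in τ..T, ∑ i, ∫ x, ‖fderiv ℝ (heatDuhamelBack ν Θ s) x
          (stdOrthonormalBasis ℝ E i)‖ ^ 2 =
      2 * ∫ s in τ..T, ∫ x, ⟪heatDuhamelBack ν Θ s x, Θ s x⟫ := by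
  set bE := stdOrthonormalBasis ℝ E
  have hΘt : IsSpaceTimeTestOn (⊤ : Opens (ℝ × E)) (timeDeriv Θ) := hΘ.timeDeriv_top
  have hΘl : IsSpaceTimeTestOn (⊤ : Opens (ℝ × E)) (fun t => Δ (Θ t)) := hΘ.laplacian_top
  obtain ⟨M, hM0, hM⟩ := hΘ.exists_norm_le
  -- Step 1: pointwise fundamental theorem of calculus
  have step1 : ∀ x, ∫ s in τ..T, 2 * ⟪heatDuhamelBack ν Θ s x,
      heatDuhamelBack ν (timeDeriv Θ) s x⟫ = -‖heatDuhamelBack ν Θ τ x‖ ^ 2 := fun x => by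
    have hd : ∀ s, HasDerivAt (fun s' => ‖heatDuhamelBack ν Θ s' x‖ ^ 2)
        (2 * ⟪heatDuhamelBack ν Θ s x, heatDuhamelBack ν (timeDeriv Θ) s x⟫) s := fun s =>
      (hΘ.hasDerivAt_heatDuhamelBack_time hν s x).norm_sq
    have hc : Continuous fun s => 2 * ⟪heatDuhamelBack ν Θ s x,
        heatDuhamelBack ν (timeDeriv Θ) s x⟫ :=
      continuous_const.mul ((hΘ.continuous_heatDuhamelBack_time hν x).inner
        (hΘt.continuous_heatDuhamelBack_time hν x))
    rw [intervalIntegral.integral_eq_sub_of_hasDerivAt (fun s _ => hd s) (hc.intervalIntegrable _ _),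
      hΘ.heatDuhamelBack_eq_zero_of_le hν hab hbT x]
    simp
  -- Step 2: integrate in `x` and swap the integrals
  have hjoint := (hΘ.integrable_prod_inner_heatDuhamelBack hΘt hν τ T).const_mul 2
  have step2 : ∫ s in Ioc τ T, ∫ x, 2 * ⟪heatDuhamelBack ν Θ s x,
      heatDuhamelBack ν (timeDeriv Θ) s x⟫ = -∫ x, ‖heatDuhamelBack ν Θ τ x‖ ^ 2 := by
    rw [← integral_neg]
    simp_rw [← step1, intervalIntegral.integral_of_le hτT]
    exact (integral_integral_swap (f := fun x s => 2 * ⟪heatDuhamelBack ν Θ s x,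
      heatDuhamelBack ν (timeDeriv Θ) s x⟫) hjoint).symm
  -- Step 3: the slice identity from the backward heat equation and integration by parts
  have step3 : ∀ s, ∫ x, 2 * ⟪heatDuhamelBack ν Θ s x, heatDuhamelBack ν (timeDeriv Θ) s x⟫ =
      2 * ν * (∑ i, ∫ x, ‖fderiv ℝ (heatDuhamelBack ν Θ s) x (bE i)‖ ^ 2) -
        2 * ∫ x, ⟪heatDuhamelBack ν Θ s x, Θ s x⟫ := fun s => by
    have hVeq : ∀ x, heatDuhamelBack ν (timeDeriv Θ) s x =
        -(ν • heatDuhamelBack ν (fun t => Δ (Θ t)) s x) - Θ s x := fun x => by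
      have h := hΘ.heatDuhamelBack_backward_heat hν s x
      rw [eq_sub_iff_add_eq, eq_neg_iff_add_eq_zero, add_assoc, add_comm (Θ s x), ← add_assoc, h,
        neg_add_cancel]
    have iW : Integrable (fun x => ⟪heatDuhamelBack ν Θ s x,
        heatDuhamelBack ν (fun t => Δ (Θ t)) s x⟫) volume :=
      hΘ.integrable_inner_heatDuhamelBack hΘl hν s
    have iΘ : Integrable (fun x => ⟪heatDuhamelBack ν Θ s x, Θ s x⟫) volume :=
      integrable_inner_of_norm_le (hΘ.continuous_heatDuhamelBack_space hν s)
        (fun x => hΘ.norm_heatDuhamelBack_le hν hM hab s x)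
        ((hΘ.contDiff_slice s).continuous.integrable_of_hasCompactSupport
          (hΘ.hasCompactSupport_slice s))
    have hfun : (fun x => 2 * ⟪heatDuhamelBack ν Θ s x, heatDuhamelBack ν (timeDeriv Θ) s x⟫) =
        fun x => (-(2 * ν)) * ⟪heatDuhamelBack ν Θ s x, heatDuhamelBack ν (fun t => Δ (Θ t)) s x⟫ -
          2 * ⟪heatDuhamelBack ν Θ s x, Θ s x⟫ := by
      funext x
      rw [hVeq x, inner_sub_right, inner_neg_right, real_inner_smul_right]
      ring
    rw [hfun, integral_sub (iW.const_mul _) (iΘ.const_mul _), integral_const_mul,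
      integral_const_mul, hΘ.integral_inner_laplacian_heatDuhamelBack hν s]
    ring
  -- Step 4: integrability in time of the two slice functionals, and assembly
  have hΘi : ∀ i, IsSpaceTimeTestOn (⊤ : Opens (ℝ × E)) (fun t y => fderiv ℝ (Θ t) y (bE i)) :=
    fun i => hΘ.fderiv_apply_top (bE i)
  -- `s ↦ ∫ ‖∂ᵢU s‖²` is the inner integral of a jointly integrable function
  have ie : ∀ i, IntegrableOn (fun s => ∫ x, ‖fderiv ℝ (heatDuhamelBack ν Θ s) x (bE i)‖ ^ 2)
      (Ioc τ T) volume := fun i => by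
    have h := ((hΘi i).integrable_prod_inner_heatDuhamelBack (hΘi i) hν τ T).integral_prod_right
    refine h.congr (Eventually.of_forall fun s => ?_)
    refine integral_congr_ae (Eventually.of_forall fun x => ?_)
    dsimp only
    rw [hΘ.fderiv_heatDuhamelBack_apply hν s x (bE i), real_inner_self_eq_norm_sq]
  have ie₁ : IntegrableOn (fun s => ∑ i, ∫ x, ‖fderiv ℝ (heatDuhamelBack ν Θ s) x (bE i)‖ ^ 2)
      (Ioc τ T) volume := integrable_finsetSum _ fun i _ => ie i
  have ip : IntegrableOn (fun s => ∫ x, ⟪heatDuhamelBack ν Θ s x, Θ s x⟫) (Ioc τ T) volume :=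
    (hΘ.integrable_prod_inner_heatDuhamelBack_test hΘ hν τ T).integral_prod_right
  -- assemble
  have h4 : ∫ s in Ioc τ T, ∫ x, 2 * ⟪heatDuhamelBack ν Θ s x,
      heatDuhamelBack ν (timeDeriv Θ) s x⟫ =
      2 * ν * (∫ s in Ioc τ T, ∑ i, ∫ x, ‖fderiv ℝ (heatDuhamelBack ν Θ s) x (bE i)‖ ^ 2) -
        2 * ∫ s in Ioc τ T, ∫ x, ⟪heatDuhamelBack ν Θ s x, Θ s x⟫ := by
    simp_rw [step3]
    rw [integral_sub (ie₁.const_mul _) (ip.const_mul _), integral_const_mul, integral_const_mul]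
  rw [intervalIntegral.integral_of_le hτT, intervalIntegral.integral_of_le hτT]
  linarith [step2, h4]


omit [MeasurableSpace E] [BorelSpace E] [CompleteSpace F] [FiniteDimensional ℝ E] in
/-- Derived data inherit the time support: if `Θ(t) = 0` off `[a, b]`, so does `∂ᵥΘ`. [folklore] -/
theorem fderiv_apply_slice_eq_zero_of_time_support {a b : ℝ} (hab : ∀ t, t ∉ Icc a b → Θ t = 0)
    (v : E) (t : ℝ) (ht : t ∉ Icc a b) : (fun y => fderiv ℝ (Θ t) y v) = 0 := by
  funext y
  rw [hab t ht]
  simp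

/-- **Second energy identity** (Lemarié-Rieusset 2016, Prop. 4.3 (C), time-reversed; maximal
regularity at the level of an identity): with the frame `eᵢ` of `E`,
`Σᵢ ‖∂ᵢU(τ)‖₂² + 2ν ∫_τ^T Σᵢ Σⱼ ‖∂ⱼ∂ᵢU(s)‖₂² ds = -2 ∫_τ^T ⟨ΔU(s), Θ(s)⟩ ds`
for `U = 𝒰[Θ]`, `τ ≤ T`, `b ≤ T`. Proof: the first energy identity for the data `∂ᵢΘ`
(`∂ᵢU = 𝒰[∂ᵢΘ]`), summed over `i`, and `Σᵢ ∫⟪∂ᵢU, ∂ᵢΘ⟫ = -∫⟪ΔU, Θ⟫` (tree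
`integral_inner_laplacian_add_eq_zero`, `Θ(s)` compactly supported). [cite: LemarieRieusset2016, Prop. 4.3 (C), p. 74] -/
theorem IsSpaceTimeTestOn.energy_identity_one
    (hΘ : IsSpaceTimeTestOn (⊤ : Opens (ℝ × E)) Θ) (hν : 0 < ν) {a b : ℝ}
    (hab : ∀ t, t ∉ Icc a b → Θ t = 0) {τ T : ℝ} (hτT : τ ≤ T) (hbT : b ≤ T) :
    (∑ i, ∫ x, ‖fderiv ℝ (heatDuhamelBack ν Θ τ) x (stdOrthonormalBasis ℝ E i)‖ ^ 2) +
        2 * ν * ∫ s in τ..T, ∑ i, ∑ j, ∫ x,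
          ‖fderiv ℝ (fun y => fderiv ℝ (heatDuhamelBack ν Θ s) y (stdOrthonormalBasis ℝ E i)) x
            (stdOrthonormalBasis ℝ E j)‖ ^ 2 =
      -2 * ∫ s in τ..T, ∫ x, ⟪(Δ (heatDuhamelBack ν Θ s)) x, Θ s x⟫ := by
  set bE := stdOrthonormalBasis ℝ E
  have hΘi : ∀ i, IsSpaceTimeTestOn (⊤ : Opens (ℝ × E)) (fun t y => fderiv ℝ (Θ t) y (bE i)) :=
    fun i => hΘ.fderiv_apply_top (bE i)
  have habi : ∀ i t, t ∉ Icc a b → (fun y => fderiv ℝ (Θ t) y (bE i)) = 0 := fun i t ht =>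
    fderiv_apply_slice_eq_zero_of_time_support hab (bE i) t ht
  -- the first identity for each `∂ᵢΘ`, rewritten through `∂ᵢU = 𝒰[∂ᵢΘ]`
  have hUi : ∀ i s, heatDuhamelBack ν (fun t y => fderiv ℝ (Θ t) y (bE i)) s =
      fun x => fderiv ℝ (heatDuhamelBack ν Θ s) x (bE i) := fun i s =>
    funext fun x => (hΘ.fderiv_heatDuhamelBack_apply hν s x (bE i)).symm
  have hEi := fun i => (hΘi i).energy_identity_zero hν (habi i) hτT hbT
  simp_rw [hUi] at hEi
  -- integrability in time of the slice functionals (to sum the interval integrals)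
  have ie : ∀ i, IntervalIntegrable (fun s => ∑ j, ∫ x,
      ‖fderiv ℝ (fun y => fderiv ℝ (heatDuhamelBack ν Θ s) y (bE i)) x (bE j)‖ ^ 2) volume τ T :=
    fun i => by
    rw [intervalIntegrable_iff_integrableOn_Ioc_of_le hτT]
    refine integrable_finsetSum _ fun j _ => ?_
    have hΘij := (hΘi i).fderiv_apply_top (bE j)
    have h := (hΘij.integrable_prod_inner_heatDuhamelBack hΘij hν τ T).integral_prod_right
    refine h.congr (Eventually.of_forall fun s => integral_congr_ae (Eventually.of_forall fun x => ?_))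
    dsimp only
    rw [← real_inner_self_eq_norm_sq, ← hUi i s, (hΘi i).fderiv_heatDuhamelBack_apply hν s x (bE j)]
  have ip : ∀ i, IntervalIntegrable (fun s => ∫ x, ⟪fderiv ℝ (heatDuhamelBack ν Θ s) x (bE i),
      fderiv ℝ (Θ s) x (bE i)⟫) volume τ T := fun i => by
    rw [intervalIntegrable_iff_integrableOn_Ioc_of_le hτT]
    have h := ((hΘi i).integrable_prod_inner_heatDuhamelBack_test (hΘi i) hν τ T).integral_prod_right
    refine h.congr (Eventually.of_forall fun s => integral_congr_ae (Eventually.of_forall fun x => ?_))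
    dsimp only
    rw [hΘ.fderiv_heatDuhamelBack_apply hν s x (bE i)]
  -- sum over `i`
  have hsum := Finset.sum_congr rfl fun i (_ : i ∈ Finset.univ) => hEi i
  rw [Finset.sum_add_distrib, ← Finset.mul_sum, ← intervalIntegral.integral_finsetSum (fun i _ => ie i),
    ← Finset.mul_sum, ← intervalIntegral.integral_finsetSum (fun i _ => ip i)] at hsum
  rw [hsum]
  -- `Σᵢ ∫⟪∂ᵢU, ∂ᵢΘ⟫ = -∫⟪ΔU, Θ⟫`
  have hXY : ∫ s in τ..T, ∑ i, ∫ x, ⟪fderiv ℝ (heatDuhamelBack ν Θ s) x (bE i),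
      fderiv ℝ (Θ s) x (bE i)⟫ = -∫ s in τ..T, ∫ x, ⟪(Δ (heatDuhamelBack ν Θ s)) x, Θ s x⟫ := by
    rw [← intervalIntegral.integral_neg]
    refine intervalIntegral.integral_congr fun s _ => ?_
    have h := integral_inner_laplacian_add_eq_zero bE (hΘ.contDiff_two_heatDuhamelBack hν s)
      (contDiff_infty.1 (hΘ.contDiff_slice s) 1) (Or.inr (hΘ.hasCompactSupport_slice s))
    linarith
  rw [hXY]
  ring



/-! ### From the identities to the estimates -/

omit [CompleteSpace F] in
/-- **Cauchy–Schwarz for pairings** on a measure space: `∫ |⟪f, g⟫| ≤ ‖f‖₂ ‖g‖₂` for square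
integrable `f, g` (real exponents). [folklore] -/
theorem integral_abs_inner_le_sqrt_mul_sqrt {α : Type*} [MeasurableSpace α] {μ : Measure α}
    {f g : α → F} (hf : MemLp f 2 μ) (hg : MemLp g 2 μ) :
    ∫ z, |⟪f z, g z⟫| ∂μ ≤ (∫ z, ‖f z‖ ^ 2 ∂μ) ^ (1 / 2 : ℝ) * (∫ z, ‖g z‖ ^ 2 ∂μ) ^ (1 / 2 : ℝ) := by
  have h2 : ENNReal.ofReal 2 = (2 : ℝ≥0∞) := by simp
  have hf' : MemLp (fun z => ‖f z‖) (ENNReal.ofReal 2) μ := by rw [h2]; exact hf.norm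
  have hg' : MemLp (fun z => ‖g z‖) (ENNReal.ofReal 2) μ := by rw [h2]; exact hg.norm
  have h := integral_mul_le_Lp_mul_Lq_of_nonneg Real.HolderConjugate.two_two
    (ae_of_all _ fun z => norm_nonneg (f z)) (ae_of_all _ fun z => norm_nonneg (g z)) hf' hg'
  refine le_trans ?_ (le_trans h (le_of_eq ?_))
  · refine integral_mono_of_nonneg (ae_of_all _ fun z => abs_nonneg _) ?_
      (ae_of_all _ fun z => abs_real_inner_le_norm _ _)
    have hi : Integrable ((fun z => ‖f z‖) * fun z => ‖g z‖) μ :=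
      MemLp.integrable_mul (p := 2) (q := 2) hf.norm hg.norm
    exact hi
  · norm_num



/-- `(x, s) ↦ ‖𝒰[Θ](s)(x)‖²` is integrable on every time slab. [folklore] -/
theorem IsSpaceTimeTestOn.integrable_prod_sq_norm_heatDuhamelBack
    (hΘ : IsSpaceTimeTestOn (⊤ : Opens (ℝ × E)) Θ) (hν : 0 < ν) (τ T : ℝ) :
    Integrable (fun q : E × ℝ => ‖heatDuhamelBack ν Θ q.2 q.1‖ ^ 2)
      ((volume : Measure E).prod (volume.restrict (Ioc τ T))) :=
  (hΘ.integrable_prod_inner_heatDuhamelBack hΘ hν τ T).congr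
    (Eventually.of_forall fun _ => real_inner_self_eq_norm_sq _)

/-- `𝒰[Θ]` is square integrable on every time slab. [folklore] -/
theorem IsSpaceTimeTestOn.memLp_two_prod_heatDuhamelBack
    (hΘ : IsSpaceTimeTestOn (⊤ : Opens (ℝ × E)) Θ) (hν : 0 < ν) (τ T : ℝ) :
    MemLp (fun q : E × ℝ => heatDuhamelBack ν Θ q.2 q.1) 2
      ((volume : Measure E).prod (volume.restrict (Ioc τ T))) := by
  have hc : Continuous fun q : E × ℝ => heatDuhamelBack ν Θ q.2 q.1 :=
    (hΘ.continuous_heatDuhamelBack hν).comp (continuous_snd.prodMk continuous_fst)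
  rw [memLp_two_iff_integrable_sq_norm hc.aestronglyMeasurable]
  exact hΘ.integrable_prod_sq_norm_heatDuhamelBack hν τ T

omit [CompleteSpace F] in
/-- A space–time test field is square integrable on every time slab, and
`(x, s) ↦ ‖Θ(s)(x)‖²` is integrable there. [folklore] -/
theorem IsSpaceTimeTestOn.integrable_prod_sq_norm (hΘ : IsSpaceTimeTestOn (⊤ : Opens (ℝ × E)) Θ)
    (τ T : ℝ) :
    Integrable (fun q : E × ℝ => ‖Θ q.2 q.1‖ ^ 2)
      ((volume : Measure E).prod (volume.restrict (Ioc τ T))) := by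
  obtain ⟨M, hM0, hM⟩ := hΘ.exists_norm_le
  obtain ⟨M₁, hM₁0, hM₁⟩ := hΘ.exists_integral_norm_slice_le
  have hGi : ∀ s, Integrable (Θ s) volume := fun s =>
    (hΘ.contDiff_slice s).continuous.integrable_of_hasCompactSupport (hΘ.hasCompactSupport_slice s)
  exact (integrable_prod_inner_of_bound hΘ.continuous_uncurry hΘ.continuous_uncurry hM hGi hM₁ τ T).congr
    (Eventually.of_forall fun _ => real_inner_self_eq_norm_sq _)

omit [CompleteSpace F] in
/-- A space–time test field is in `L²` of every time slab. [folklore] -/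
theorem IsSpaceTimeTestOn.memLp_two_prod (hΘ : IsSpaceTimeTestOn (⊤ : Opens (ℝ × E)) Θ)
    (τ T : ℝ) :
    MemLp (fun q : E × ℝ => Θ q.2 q.1) 2 ((volume : Measure E).prod (volume.restrict (Ioc τ T))) := by
  have hc : Continuous fun q : E × ℝ => Θ q.2 q.1 :=
    hΘ.continuous_uncurry.comp (continuous_snd.prodMk continuous_fst)
  rw [memLp_two_iff_integrable_sq_norm hc.aestronglyMeasurable]
  exact hΘ.integrable_prod_sq_norm τ T

omit [CompleteSpace F] in
/-- The squared `L²` norm of a space–time test field on the slab `(τ, T] × E` as an iterated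
integral, `∫_τ^T ∫ |Θ(s, x)|² dx ds`. [folklore] -/
theorem IsSpaceTimeTestOn.integral_prod_sq_norm_eq (hΘ : IsSpaceTimeTestOn (⊤ : Opens (ℝ × E)) Θ)
    {τ T : ℝ} (hτT : τ ≤ T) :
    ∫ q, ‖Θ q.2 q.1‖ ^ 2 ∂((volume : Measure E).prod (volume.restrict (Ioc τ T))) =
      ∫ s in τ..T, ∫ x, ‖Θ s x‖ ^ 2 := by
  rw [integral_prod_symm _ (hΘ.integrable_prod_sq_norm τ T), intervalIntegral.integral_of_le hτT]

/-- **`L²` energy estimate for the backward Duhamel integral** (Lemarié-Rieusset 2016,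
Prop. 4.3 (B): `‖U(t)‖₂² + ν∫‖∇U‖₂² ≤ ν⁻¹∫‖g‖₂²`; here in the backward form and with the
short-time gain). For `U = 𝒰[Θ]`, `Θ` supported in time in `[a, b]`, `τ₀ ≤ T`, `b ≤ T`, and
`Q = ∫_{τ₀}^T ‖Θ(s)‖₂² ds`:
`sup_{τ ∈ [τ₀, T]} ‖U(τ)‖₂² ≤ 4 (T - τ₀) Q` and `∫_{τ₀}^T Σᵢ ‖∂ᵢU(s)‖₂² ds ≤ (2 (T - τ₀)/ν) Q`.
Proof: by the first energy identity `‖U(τ)‖₂² ≤ 2J` with `J = ∫∫ |⟪U, Θ⟫|`; by Cauchy–Schwarz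
on the slab `J ≤ ‖U‖_{L²(slab)} Q^{1/2} ≤ (2J(T - τ₀))^{1/2} Q^{1/2}`, whence `J ≤ 2 (T - τ₀) Q`,
and `2ν ∫ Σᵢ ‖∂ᵢU‖₂² ≤ 2J`. [cite: LemarieRieusset2016, Prop. 4.3 (B), p. 74] -/
theorem IsSpaceTimeTestOn.energy_estimate_zero
    (hΘ : IsSpaceTimeTestOn (⊤ : Opens (ℝ × E)) Θ) (hν : 0 < ν) {a b : ℝ}
    (hab : ∀ t, t ∉ Icc a b → Θ t = 0) {τ₀ T : ℝ} (hτ₀T : τ₀ ≤ T) (hbT : b ≤ T) :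
    (∀ τ ∈ Icc τ₀ T, ∫ x, ‖heatDuhamelBack ν Θ τ x‖ ^ 2 ≤
        4 * (T - τ₀) * ∫ s in τ₀..T, ∫ x, ‖Θ s x‖ ^ 2) ∧
      ∫ s in τ₀..T, ∑ i, ∫ x, ‖fderiv ℝ (heatDuhamelBack ν Θ s) x (stdOrthonormalBasis ℝ E i)‖ ^ 2 ≤
        2 * (T - τ₀) / ν * ∫ s in τ₀..T, ∫ x, ‖Θ s x‖ ^ 2 := by
  set bE := stdOrthonormalBasis ℝ E
  set μ : Measure (E × ℝ) := (volume : Measure E).prod (volume.restrict (Ioc τ₀ T)) with hμ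
  set Q : ℝ := ∫ s in τ₀..T, ∫ x, ‖Θ s x‖ ^ 2 with hQ
  have hQ' : ∫ q, ‖Θ q.2 q.1‖ ^ 2 ∂μ = Q := hΘ.integral_prod_sq_norm_eq hτ₀T
  have hQ0 : 0 ≤ Q := by
    rw [← hQ']
    exact integral_nonneg fun _ => by positivity
  -- the pairing `J`
  have hjoint := hΘ.integrable_prod_inner_heatDuhamelBack_test hΘ hν τ₀ T
  set J : ℝ := ∫ q, |⟪heatDuhamelBack ν Θ q.2 q.1, Θ q.2 q.1⟫| ∂μ with hJ
  have hJ0 : 0 ≤ J := integral_nonneg fun _ => abs_nonneg _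
  have hJ_iter : J = ∫ s in Ioc τ₀ T, ∫ x, |⟪heatDuhamelBack ν Θ s x, Θ s x⟫| := by
    rw [hJ, integral_prod_symm _ hjoint.abs]
  -- integrability in time of the slice functionals
  have hΘi : ∀ i, IsSpaceTimeTestOn (⊤ : Opens (ℝ × E)) (fun t y => fderiv ℝ (Θ t) y (bE i)) :=
    fun i => hΘ.fderiv_apply_top (bE i)
  have ie₁ : IntervalIntegrable (fun s => ∑ i, ∫ x,
      ‖fderiv ℝ (heatDuhamelBack ν Θ s) x (bE i)‖ ^ 2) volume τ₀ T := by
    rw [intervalIntegrable_iff_integrableOn_Ioc_of_le hτ₀T]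
    refine integrable_finsetSum _ fun i _ => ?_
    have h := ((hΘi i).integrable_prod_sq_norm_heatDuhamelBack hν τ₀ T).integral_prod_right
    refine h.congr (Eventually.of_forall fun s => integral_congr_ae (Eventually.of_forall fun x => ?_))
    dsimp only
    rw [hΘ.fderiv_heatDuhamelBack_apply hν s x (bE i)]
  have ipabs : IntervalIntegrable (fun s => ∫ x, |⟪heatDuhamelBack ν Θ s x, Θ s x⟫|) volume τ₀ T := by
    rw [intervalIntegrable_iff_integrableOn_Ioc_of_le hτ₀T]
    exact hjoint.abs.integral_prod_right
  have ip : IntervalIntegrable (fun s => ∫ x, ⟪heatDuhamelBack ν Θ s x, Θ s x⟫) volume τ₀ T := by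
    rw [intervalIntegrable_iff_integrableOn_Ioc_of_le hτ₀T]
    exact hjoint.integral_prod_right
  -- (i) `‖U(τ)‖₂² ≤ 2J` and `2ν ∫ e₁ ≤ 2J`
  have hboth : ∀ τ ∈ Icc τ₀ T, (∫ x, ‖heatDuhamelBack ν Θ τ x‖ ^ 2) ≤ 2 * J ∧
      2 * ν * (∫ s in τ..T, ∑ i, ∫ x, ‖fderiv ℝ (heatDuhamelBack ν Θ s) x (bE i)‖ ^ 2) ≤ 2 * J := by
    intro τ hτ
    have hE := hΘ.energy_identity_zero hν hab hτ.2 hbT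
    have hB0 : 0 ≤ ∫ s in τ..T, ∑ i, ∫ x, ‖fderiv ℝ (heatDuhamelBack ν Θ s) x (bE i)‖ ^ 2 :=
      intervalIntegral.integral_nonneg hτ.2 fun s _ =>
        Finset.sum_nonneg fun i _ => integral_nonneg fun _ => by positivity
    have hA0 : 0 ≤ ∫ x, ‖heatDuhamelBack ν Θ τ x‖ ^ 2 := integral_nonneg fun _ => by positivity
    have hP : ∫ s in τ..T, ∫ x, ⟪heatDuhamelBack ν Θ s x, Θ s x⟫ ≤ J := by
      have hsub : uIcc τ T ⊆ uIcc τ₀ T := uIcc_subset_uIcc_right (by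
        rw [uIcc_of_le hτ₀T]; exact hτ)
      calc ∫ s in τ..T, ∫ x, ⟪heatDuhamelBack ν Θ s x, Θ s x⟫
          ≤ ∫ s in τ..T, ∫ x, |⟪heatDuhamelBack ν Θ s x, Θ s x⟫| :=
            intervalIntegral.integral_mono_on hτ.2 (ip.mono_set hsub) (ipabs.mono_set hsub)
              fun s _ => (le_abs_self _).trans abs_integral_le_integral_abs
        _ ≤ ∫ s in τ₀..T, ∫ x, |⟪heatDuhamelBack ν Θ s x, Θ s x⟫| :=
            intervalIntegral.integral_mono_interval hτ.1 hτ.2 le_rfl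
              (Eventually.of_forall fun s => integral_nonneg fun _ => abs_nonneg _) ipabs
        _ = J := by rw [hJ_iter, intervalIntegral.integral_of_le hτ₀T]
    constructor
    · nlinarith
    · nlinarith
  -- (ii) Cauchy–Schwarz on the slab
  have hCS : J ≤ (∫ q, ‖heatDuhamelBack ν Θ q.2 q.1‖ ^ 2 ∂μ) ^ (1 / 2 : ℝ) * Q ^ (1 / 2 : ℝ) := by
    rw [← hQ']
    exact integral_abs_inner_le_sqrt_mul_sqrt (hΘ.memLp_two_prod_heatDuhamelBack hν τ₀ T)
      (hΘ.memLp_two_prod τ₀ T)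
  -- (iii) `‖U‖²_{L²(slab)} ≤ 2J (T - τ₀)`
  have hUU : ∫ q, ‖heatDuhamelBack ν Θ q.2 q.1‖ ^ 2 ∂μ ≤ 2 * J * (T - τ₀) := by
    rw [hμ, integral_prod_symm _ (hΘ.integrable_prod_sq_norm_heatDuhamelBack hν τ₀ T)]
    have hi : IntegrableOn (fun s => ∫ x, ‖heatDuhamelBack ν Θ s x‖ ^ 2) (Ioc τ₀ T) volume :=
      (hΘ.integrable_prod_sq_norm_heatDuhamelBack hν τ₀ T).integral_prod_right
    calc ∫ s in Ioc τ₀ T, ∫ x, ‖heatDuhamelBack ν Θ s x‖ ^ 2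
        ≤ ∫ s in Ioc τ₀ T, 2 * J := by
          exact setIntegral_mono_on hi (integrableOn_const measure_Ioc_lt_top.ne)
            measurableSet_Ioc fun s hs => (hboth s ⟨hs.1.le, hs.2⟩).1
      _ = 2 * J * (T - τ₀) := by
          rw [setIntegral_const, smul_eq_mul, Real.volume_real_Ioc_of_le hτ₀T]
          ring
  -- (iv) `J ≤ 2 (T - τ₀) Q`
  have hJle : J ≤ 2 * (T - τ₀) * Q := by
    have hδ : 0 ≤ T - τ₀ := sub_nonneg.2 hτ₀T
    have h1 : J ≤ (2 * J * (T - τ₀)) ^ (1 / 2 : ℝ) * Q ^ (1 / 2 : ℝ) :=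
      hCS.trans (mul_le_mul_of_nonneg_right (Real.rpow_le_rpow
        (integral_nonneg fun _ => by positivity) hUU (by norm_num)) (Real.rpow_nonneg hQ0 _))
    rw [← Real.sqrt_eq_rpow, ← Real.sqrt_eq_rpow, ← Real.sqrt_mul (by positivity)] at h1
    have h2 : J ^ 2 ≤ 2 * J * (T - τ₀) * Q := by
      calc J ^ 2 ≤ (Real.sqrt (2 * J * (T - τ₀) * Q)) ^ 2 := by gcongr
        _ = 2 * J * (T - τ₀) * Q := Real.sq_sqrt (by positivity)
    by_cases hJpos : J ≤ 0
    · have : J = 0 := le_antisymm hJpos hJ0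
      rw [this]; positivity
    · push Not at hJpos
      have h3 : J * J ≤ (2 * (T - τ₀) * Q) * J := by nlinarith
      exact le_of_mul_le_mul_right h3 hJpos
  -- (v) conclusions
  refine ⟨fun τ hτ => ?_, ?_⟩
  · have h := (hboth τ hτ).1
    nlinarith
  · have h := (hboth τ₀ ⟨le_rfl, hτ₀T⟩).2
    rw [div_mul_eq_mul_div, le_div_iff₀ hν]
    nlinarith



omit [MeasurableSpace E] [BorelSpace E] [CompleteSpace F] in
/-- `‖Δv(x)‖² ≤ n Σᵢ Σⱼ ‖∂ⱼ∂ᵢ v(x)‖²` for `C²` fields (`Δ = Σᵢ ∂ᵢ∂ᵢ` and Cauchy–Schwarz for the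
finite sum). [folklore] -/
theorem norm_laplacian_sq_le {v : E → F} (hv : ContDiff ℝ 2 v) (x : E) :
    ‖(Δ v) x‖ ^ 2 ≤ (Module.finrank ℝ E : ℝ) * ∑ i, ∑ j,
      ‖fderiv ℝ (fun y => fderiv ℝ v y (stdOrthonormalBasis ℝ E i)) x (stdOrthonormalBasis ℝ E j)‖ ^ 2 := by
  set bE := stdOrthonormalBasis ℝ E
  rw [laplacian_eq_sum_fderiv_fderiv_normed bE hv x]
  have h1 : ‖∑ i, fderiv ℝ (fun y => fderiv ℝ v y (bE i)) x (bE i)‖ ^ 2 ≤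
      (∑ i, ‖fderiv ℝ (fun y => fderiv ℝ v y (bE i)) x (bE i)‖) ^ 2 := by
    gcongr
    exact norm_sum_le _ _
  have h2 : (∑ i, ‖fderiv ℝ (fun y => fderiv ℝ v y (bE i)) x (bE i)‖) ^ 2 ≤
      ((Finset.univ : Finset (Fin (Module.finrank ℝ E))).card : ℝ) * ∑ i, ‖fderiv ℝ (fun y => fderiv ℝ v y (bE i)) x (bE i)‖ ^ 2 :=
    sq_sum_le_card_mul_sum_sq (s := Finset.univ)
      (f := fun i => ‖fderiv ℝ (fun y => fderiv ℝ v y (bE i)) x (bE i)‖)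
  have h3 : ∀ i, ‖fderiv ℝ (fun y => fderiv ℝ v y (bE i)) x (bE i)‖ ^ 2 ≤
      ∑ j, ‖fderiv ℝ (fun y => fderiv ℝ v y (bE i)) x (bE j)‖ ^ 2 := fun i =>
    Finset.single_le_sum (f := fun j => ‖fderiv ℝ (fun y => fderiv ℝ v y (bE i)) x (bE j)‖ ^ 2)
      (fun j _ => by positivity) (Finset.mem_univ i)
  have hcard : ((Finset.univ : Finset (Fin (Module.finrank ℝ E))).card : ℝ) = (Module.finrank ℝ E : ℝ) := by
    simp [Finset.card_univ, Fintype.card_fin]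
  calc ‖∑ i, fderiv ℝ (fun y => fderiv ℝ v y (bE i)) x (bE i)‖ ^ 2
      ≤ ((Finset.univ : Finset (Fin (Module.finrank ℝ E))).card : ℝ) * ∑ i, ‖fderiv ℝ (fun y => fderiv ℝ v y (bE i)) x (bE i)‖ ^ 2 :=
        h1.trans h2
    _ ≤ (Module.finrank ℝ E : ℝ) * ∑ i, ∑ j, ‖fderiv ℝ (fun y => fderiv ℝ v y (bE i)) x (bE j)‖ ^ 2 := by
        rw [hcard]
        exact mul_le_mul_of_nonneg_left (Finset.sum_le_sum fun i _ => h3 i) (by positivity)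

/-- **`L²` maximal regularity for the backward Duhamel integral** (Lemarié-Rieusset 2016,
Prop. 4.3 (C): `ν² ∫‖V‖₂² ≤ ∫‖h‖₂²` for `V = ∫₀ᵗ W_{ν(t-s)} * Δh ds`; here for all second
derivatives of `U = 𝒰[Θ]`, in the backward form). For `Θ` supported in time in `[a, b]`,
`τ₀ ≤ T`, `b ≤ T`:
`∫_{τ₀}^T Σᵢ Σⱼ ‖∂ⱼ∂ᵢU(s)‖₂² ds ≤ (n/ν²) ∫_{τ₀}^T ‖Θ(s)‖₂² ds`, `n = dim E`.
Proof: by the second energy identity `2ν X ≤ 2 ∫∫|⟪ΔU, Θ⟫| ≤ 2 ‖ΔU‖_{L²(slab)} Q^{1/2}` and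
`‖ΔU‖²_{L²(slab)} ≤ n X` (`‖Δv‖² ≤ n Σᵢⱼ ‖∂ⱼ∂ᵢv‖²`). [cite: LemarieRieusset2016, Prop. 4.3 (C), p. 74] -/
theorem IsSpaceTimeTestOn.energy_estimate_one
    (hΘ : IsSpaceTimeTestOn (⊤ : Opens (ℝ × E)) Θ) (hν : 0 < ν) {a b : ℝ}
    (hab : ∀ t, t ∉ Icc a b → Θ t = 0) {τ₀ T : ℝ} (hτ₀T : τ₀ ≤ T) (hbT : b ≤ T) :
    ∫ s in τ₀..T, ∑ i, ∑ j, ∫ x,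
        ‖fderiv ℝ (fun y => fderiv ℝ (heatDuhamelBack ν Θ s) y (stdOrthonormalBasis ℝ E i)) x
          (stdOrthonormalBasis ℝ E j)‖ ^ 2 ≤
      (Module.finrank ℝ E : ℝ) / ν ^ 2 * ∫ s in τ₀..T, ∫ x, ‖Θ s x‖ ^ 2 := by
  set bE := stdOrthonormalBasis ℝ E
  set n : ℝ := (Module.finrank ℝ E : ℝ) with hn
  set μ : Measure (E × ℝ) := (volume : Measure E).prod (volume.restrict (Ioc τ₀ T)) with hμ
  set Q : ℝ := ∫ s in τ₀..T, ∫ x, ‖Θ s x‖ ^ 2 with hQ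
  have hQ' : ∫ q, ‖Θ q.2 q.1‖ ^ 2 ∂μ = Q := hΘ.integral_prod_sq_norm_eq hτ₀T
  have hQ0 : 0 ≤ Q := by
    rw [← hQ']
    exact integral_nonneg fun _ => by positivity
  have hΘl : IsSpaceTimeTestOn (⊤ : Opens (ℝ × E)) (fun t => Δ (Θ t)) := hΘ.laplacian_top
  have hΘi : ∀ i, IsSpaceTimeTestOn (⊤ : Opens (ℝ × E)) (fun t y => fderiv ℝ (Θ t) y (bE i)) :=
    fun i => hΘ.fderiv_apply_top (bE i)
  have hΔ : ∀ s x, (Δ (heatDuhamelBack ν Θ s)) x = heatDuhamelBack ν (fun t => Δ (Θ t)) s x :=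
    fun s x => hΘ.laplacian_heatDuhamelBack hν s x
  -- the left-hand side `X` and its slicewise integrability
  set X : ℝ := ∫ s in τ₀..T, ∑ i, ∑ j, ∫ x,
    ‖fderiv ℝ (fun y => fderiv ℝ (heatDuhamelBack ν Θ s) y (bE i)) x (bE j)‖ ^ 2 with hX
  have hUi : ∀ i s, heatDuhamelBack ν (fun t y => fderiv ℝ (Θ t) y (bE i)) s =
      fun x => fderiv ℝ (heatDuhamelBack ν Θ s) x (bE i) := fun i s =>
    funext fun x => (hΘ.fderiv_heatDuhamelBack_apply hν s x (bE i)).symm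
  -- second derivatives: `∂ⱼ∂ᵢU = 𝒰[∂ⱼ∂ᵢΘ]`
  have hUij : ∀ i j s x, fderiv ℝ (fun y => fderiv ℝ (heatDuhamelBack ν Θ s) y (bE i)) x (bE j) =
      heatDuhamelBack ν (fun t y => fderiv ℝ (fun z => fderiv ℝ (Θ t) z (bE i)) y (bE j)) s x :=
    fun i j s x => by
    rw [← hUi i s]
    exact (hΘi i).fderiv_heatDuhamelBack_apply hν s x (bE j)
  have iij : ∀ i j s, Integrable (fun x =>
      ‖fderiv ℝ (fun y => fderiv ℝ (heatDuhamelBack ν Θ s) y (bE i)) x (bE j)‖ ^ 2) volume :=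
    fun i j s => by
    have hm := ((hΘi i).fderiv_apply_top (bE j)).memLp_two_heatDuhamelBack hν s
    have h := (memLp_two_iff_integrable_sq_norm hm.1).1 hm
    refine h.congr (Eventually.of_forall fun x => ?_)
    simp only [hUij]
  -- slicewise integrability in time of `e₂(s) = Σᵢⱼ ∫ ‖∂ⱼ∂ᵢU(s)‖²`
  have ie₂ : IntegrableOn (fun s => ∑ i, ∑ j, ∫ x,
      ‖fderiv ℝ (fun y => fderiv ℝ (heatDuhamelBack ν Θ s) y (bE i)) x (bE j)‖ ^ 2)
      (Ioc τ₀ T) volume := by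
    refine integrable_finsetSum _ fun i _ => integrable_finsetSum _ fun j _ => ?_
    have hΘij := (hΘi i).fderiv_apply_top (bE j)
    have h := (hΘij.integrable_prod_sq_norm_heatDuhamelBack hν τ₀ T).integral_prod_right
    refine h.congr (Eventually.of_forall fun s => integral_congr_ae (Eventually.of_forall fun x => ?_))
    simp only [hUij]
  have hX0 : 0 ≤ X :=
    intervalIntegral.integral_nonneg hτ₀T fun s _ => Finset.sum_nonneg fun i _ =>
      Finset.sum_nonneg fun j _ => integral_nonneg fun _ => by positivity
  -- the pairing `J₂ = ∫∫ |⟪ΔU, Θ⟫|`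
  have hjoint := hΘl.integrable_prod_inner_heatDuhamelBack_test hΘ hν τ₀ T
  set J : ℝ := ∫ q, |⟪heatDuhamelBack ν (fun t => Δ (Θ t)) q.2 q.1, Θ q.2 q.1⟫| ∂μ with hJ
  have hJ0 : 0 ≤ J := integral_nonneg fun _ => abs_nonneg _
  -- (i) `2ν X ≤ 2J` from the second energy identity
  have h2νX : 2 * ν * X ≤ 2 * J := by
    have hE := hΘ.energy_identity_one hν hab hτ₀T hbT
    have hS0 : 0 ≤ ∑ i, ∫ x, ‖fderiv ℝ (heatDuhamelBack ν Θ τ₀) x (bE i)‖ ^ 2 :=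
      Finset.sum_nonneg fun i _ => integral_nonneg fun _ => by positivity
    have hP : -(∫ s in τ₀..T, ∫ x, ⟪(Δ (heatDuhamelBack ν Θ s)) x, Θ s x⟫) ≤ J := by
      have ipabs : IntervalIntegrable (fun s => ∫ x,
          |⟪heatDuhamelBack ν (fun t => Δ (Θ t)) s x, Θ s x⟫|) volume τ₀ T := by
        rw [intervalIntegrable_iff_integrableOn_Ioc_of_le hτ₀T]
        exact hjoint.abs.integral_prod_right
      have ip : IntervalIntegrable (fun s => ∫ x,
          ⟪heatDuhamelBack ν (fun t => Δ (Θ t)) s x, Θ s x⟫) volume τ₀ T := by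
        rw [intervalIntegrable_iff_integrableOn_Ioc_of_le hτ₀T]
        exact hjoint.integral_prod_right
      simp_rw [hΔ]
      rw [← intervalIntegral.integral_neg]
      calc ∫ s in τ₀..T, -∫ x, ⟪heatDuhamelBack ν (fun t => Δ (Θ t)) s x, Θ s x⟫
          ≤ ∫ s in τ₀..T, ∫ x, |⟪heatDuhamelBack ν (fun t => Δ (Θ t)) s x, Θ s x⟫| :=
            intervalIntegral.integral_mono_on hτ₀T ip.neg ipabs fun s _ =>
              (neg_le_abs _).trans abs_integral_le_integral_abs
        _ = J := by rw [hJ, integral_prod_symm _ hjoint.abs, intervalIntegral.integral_of_le hτ₀T]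
    linarith
  -- (ii) Cauchy–Schwarz and `‖ΔU‖²_{L²(slab)} ≤ n X`
  have hCS : J ≤ (∫ q, ‖heatDuhamelBack ν (fun t => Δ (Θ t)) q.2 q.1‖ ^ 2 ∂μ) ^ (1 / 2 : ℝ) *
      Q ^ (1 / 2 : ℝ) := by
    rw [← hQ']
    exact integral_abs_inner_le_sqrt_mul_sqrt (hΘl.memLp_two_prod_heatDuhamelBack hν τ₀ T)
      (hΘ.memLp_two_prod τ₀ T)
  have hΔΔ : ∫ q, ‖heatDuhamelBack ν (fun t => Δ (Θ t)) q.2 q.1‖ ^ 2 ∂μ ≤ n * X := by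
    rw [hμ, integral_prod_symm _ (hΘl.integrable_prod_sq_norm_heatDuhamelBack hν τ₀ T), hX,
      intervalIntegral.integral_of_le hτ₀T, ← integral_const_mul]
    have hi : IntegrableOn (fun s => ∫ x, ‖heatDuhamelBack ν (fun t => Δ (Θ t)) s x‖ ^ 2)
        (Ioc τ₀ T) volume :=
      (hΘl.integrable_prod_sq_norm_heatDuhamelBack hν τ₀ T).integral_prod_right
    refine setIntegral_mono_on hi (ie₂.const_mul n) measurableSet_Ioc fun s _ => ?_
    -- slicewise: `∫ ‖ΔU(s)‖² ≤ n Σᵢⱼ ∫ ‖∂ⱼ∂ᵢU(s)‖²`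
    dsimp only
    have isum : Integrable (fun x => ∑ i, ∑ j,
        ‖fderiv ℝ (fun y => fderiv ℝ (heatDuhamelBack ν Θ s) y (bE i)) x (bE j)‖ ^ 2) volume :=
      integrable_finsetSum _ fun i _ => integrable_finsetSum _ fun j _ => iij i j s
    have hrhs : ∫ x, n * ∑ i, ∑ j,
        ‖fderiv ℝ (fun y => fderiv ℝ (heatDuhamelBack ν Θ s) y (bE i)) x (bE j)‖ ^ 2 =
        n * ∑ i, ∑ j, ∫ x,
          ‖fderiv ℝ (fun y => fderiv ℝ (heatDuhamelBack ν Θ s) y (bE i)) x (bE j)‖ ^ 2 := by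
      rw [integral_const_mul, integral_finsetSum _ fun i _ =>
        integrable_finsetSum _ fun j _ => iij i j s]
      congr 1
      exact Finset.sum_congr rfl fun i _ => integral_finsetSum _ fun j _ => iij i j s
    rw [← hrhs]
    refine integral_mono_of_nonneg (Eventually.of_forall fun _ => by positivity) (isum.const_mul n)
      (Eventually.of_forall fun x => ?_)
    dsimp only
    rw [← hΔ s x]
    exact norm_laplacian_sq_le (hΘ.contDiff_two_heatDuhamelBack hν s) x
  -- (iii) algebra: `ν X ≤ (n X)^{1/2} Q^{1/2}` gives `X ≤ n Q / ν²`
  have hnX0 : 0 ≤ n * X := by positivity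
  have h1 : ν * X ≤ Real.sqrt (n * X * Q) := by
    have h := hCS.trans (mul_le_mul_of_nonneg_right (Real.rpow_le_rpow
      (integral_nonneg fun _ => by positivity) hΔΔ (by norm_num)) (Real.rpow_nonneg hQ0 _))
    rw [← Real.sqrt_eq_rpow, ← Real.sqrt_eq_rpow, ← Real.sqrt_mul hnX0] at h
    linarith
  have h2 : (ν * X) ^ 2 ≤ n * X * Q := by
    calc (ν * X) ^ 2 ≤ (Real.sqrt (n * X * Q)) ^ 2 := by gcongr
      _ = n * X * Q := Real.sq_sqrt (by positivity)
  by_cases hXpos : X ≤ 0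
  · have : X = 0 := le_antisymm hXpos hX0
    rw [this]
    positivity
  · push Not at hXpos
    rw [div_mul_eq_mul_div, le_div_iff₀ (by positivity)]
    have h3 : (X * ν ^ 2) * X ≤ (n * Q) * X := by nlinarith
    exact le_of_mul_le_mul_right h3 hXpos


end Energy

end Literature.Analysis.FluidPDE
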